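import Literature.Barriers.Schanuel.NesterenkoModularScopeConjecture
import Literature.Barriers.Schanuel.NesterenkoModularScopeMahlerLimit
import Literature.Barriers.Schanuel.NesterenkoModularScopeHolds
import Literature.Barriers.Schanuel.LargeTranscendenceDegree
import Literature.NumberTheory.Transcendental.CalegariDimitrovTangL2Chi3Reduction
import Mathlib.Analysis.SpecialFunctions.Gaussian.PoissonSummation

/-!
# Door (M): the modular parameter `τ = i/π` — `e`, `π`, `e^{π²}` in one `SL₂(ℤ)`-orbit

Soloist file (`solo-Schanuel-informed`, 2026-08-19, s8), part 1 of 3 (identities and the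
unconditional floor; part 2 `SoloInformedModularDoorRungs` = the conditional rungs; part 3
`SoloInformedModularDoorConjecture` = the quasi-modular conjecture as a named hypothesis).
Bookkeeping over theorems PROVED in the tree (Nesterenko 1996 Theorem 1.1,
`nesterenko1996_thm_1_1_holds`; the `q`-expansions `ramanujanP_cexp`, `ramanujanQ_cexp`,
`ramanujanR_cexp`; the `SL₂(ℤ)` behaviour `E2_smul`, `E₄_slash_smul`, `E₆_slash_smul`; Mathlib's
Poisson summation `Real.tsum_exp_neg_mul_int_sq`). No new transcendence input.

The point. At `τ₀ = i/π ∈ ℍ` the nome is `q = e^{2πiτ₀} = e^{−2}` and the `S`-image is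
`Sτ₀ = −1/τ₀ = iπ` with nome `q' = e^{−2π²}`; the six numbers
`F₆ = {e, π, e^{π²}, P(e^{−2}), Q(e^{−2}), R(e^{−2})}` generate a field containing Nesterenko's
quadruple at BOTH nomes (`ramanujanP/Q/R_exp_neg_two_pi_sq`: `P(q') = (6 − P(q))/π²`,
`Q(q') = Q(q)/π⁴`, `R(q') = −R(q)/π⁶`), and Jacobi's imaginary transformation at `t = 1/π` reads
`Σ_{n∈ℤ} e^{−n²} = √π · Σ_{n∈ℤ} e^{−π²n²}` (`tsum_exp_neg_sq_eq`): the rank-one triple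
`e, π, e^{π²}` of `SoloInformedPiELadder` (R1 = `TwoOfEPiExpPiSq`) is one theta identity.

PROVED here (unconditional): `3 ≤ trdeg ℚ(e^{−2}, P, Q, R)` (Theorem 1.1 at `q`),
`3 ≤ trdeg ℚ(π, e^{−2π²}, P, Q, R)` (Theorem 1.1 at `q'` pulled back by the identities) and
`3 ≤ trdeg F₆`, with `P, Q, R` taken at `e^{−2}` throughout; and that `i/π`, `iπ` are not
imaginary quadratic (irrationality of `π²`), which is what makes the non-CM clause of the
quasi-modular conjecture [cite: Fonseca2020, Conjecture 4.8] (after [cite: Bertolin2002],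
cf. [cite: Waldschmidt2004, §3]) and Nesterenko's Conjecture 1.11
[cite: NesterenkoPhilippon2001, Ch. 3 Conjecture 1.11] bite at these two points (parts 2, 3).

So `e ⟂ π` is "the fifth element" of a Nesterenko configuration in two ways: `e` added to
`{π, e^π, Γ(1/4)}` (`τ = i`, CM: no uniform modular conjecture predicts it; listed open in
[cite: Waldschmidt2008, §5.7]) and `π` added to `{e^{−2}, P, Q, R}` (`τ = i/π`, non-CM: predicted
by the uniform quasi-modular conjecture, part 3). The door is typed, not walked: the method behind
Theorem 1.1 sees `K`-functions of `q` only; `τ = log q/(2πi)` and `2πi` are exactly what it does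
not reach (barrier `NesterenkoModularScope`; "a proof … seems out of reach", Fonseca loc. cit.).
-/

noncomputable section

open Complex IntermediateField ModularGroup
open UpperHalfPlane hiding I
open scoped Real MatrixGroups
open Literature.Barriers.Schanuel (ramanujanP ramanujanQ ramanujanR ramanujanP_cexp ramanujanQ_cexp
  ramanujanR_cexp E2_smul E₄_slash_smul E₆_slash_smul nesterenko1996_thm_1_1_holds
  three_le_trdeg_adjoin_of_thm_1_1 trdeg_mono)

namespace Summit.Schanuel.Schanuel.Theorems

/-! ### §1 Jacobi's imaginary transformation at `t = 1/π` -/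

/-- **`Σ_{n∈ℤ} e^{−n²} = √π · Σ_{n∈ℤ} e^{−π²n²}`**: Poisson summation
(`Real.tsum_exp_neg_mul_int_sq` with `a = 1/π`), i.e. `θ(1/π) = √π θ(π)` for
`θ(t) = Σ e^{−πn²t}`; the theta values at the two nomes `e^{−1}` and `e^{−π²}` of the orbit
`{i/π, iπ}` differ by `√π`. [folklore] -/
theorem tsum_exp_neg_sq_eq :
    ∑' n : ℤ, Real.exp (-((n : ℝ) ^ 2)) =
      Real.sqrt π * ∑' n : ℤ, Real.exp (-(π ^ 2 * (n : ℝ) ^ 2)) := by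
  have h := Real.tsum_exp_neg_mul_int_sq (a := π⁻¹) (inv_pos.mpr Real.pi_pos)
  have hL : ∑' n : ℤ, Real.exp (-π * π⁻¹ * (n : ℝ) ^ 2) = ∑' n : ℤ, Real.exp (-((n : ℝ) ^ 2)) :=
    tsum_congr fun n => by rw [neg_mul, mul_inv_cancel₀ Real.pi_ne_zero, neg_mul, one_mul]
  have hR : ∑' n : ℤ, Real.exp (-π / π⁻¹ * (n : ℝ) ^ 2) =
      ∑' n : ℤ, Real.exp (-(π ^ 2 * (n : ℝ) ^ 2)) :=
    tsum_congr fun n => by congr 1; rw [div_inv_eq_mul]; ring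
  have hc : 1 / (π⁻¹ : ℝ) ^ (1 / 2 : ℝ) = Real.sqrt π := by
    rw [Real.inv_rpow Real.pi_pos.le, one_div, inv_inv, Real.sqrt_eq_rpow]
  rw [hL, hR, hc] at h
  exact h

/-- Squared form: **`(Σ_{n∈ℤ} e^{−n²})² = π · (Σ_{n∈ℤ} e^{−π²n²})²`** — `π` is the ratio of the
squares of two theta values at the nomes `1/e` and `e^{−π²}`. [folklore] -/
theorem tsum_exp_neg_sq_sq_eq :
    (∑' n : ℤ, Real.exp (-((n : ℝ) ^ 2))) ^ 2 =
      π * (∑' n : ℤ, Real.exp (-(π ^ 2 * (n : ℝ) ^ 2))) ^ 2 := by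
  rw [tsum_exp_neg_sq_eq, mul_pow, Real.sq_sqrt Real.pi_pos.le]

/-! ### §2 The point `τ₀ = i/π`, its `S`-image `iπ`, and the values at `e^{−2π²}` -/

/-- `Im(i/π) = 1/π > 0`: `τ₀ = i/π` lies in `ℍ`. -/
theorem im_I_div_pi_pos : 0 < (I / (π : ℂ)).im := by
  rw [div_ofReal_im, Complex.I_im]; positivity

/-- `2πi · (i/π) = −2`. -/
theorem two_pi_I_mul_I_div_pi : 2 * (π : ℂ) * I * (I / π) = -2 := by
  have hπ : (π : ℂ) ≠ 0 := ofReal_ne_zero.mpr Real.pi_ne_zero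
  calc 2 * (π : ℂ) * I * (I / π) = 2 * (I * I) * ((π : ℂ) / π) := by ring
    _ = -2 := by rw [I_mul_I, div_self hπ]; ring

/-- The nome at `τ₀ = i/π`: `e^{2πiτ₀} = e^{−2}`. -/
theorem cexp_two_pi_I_mul_I_div_pi :
    cexp (2 * π * I * ((UpperHalfPlane.mk (I / π) im_I_div_pi_pos : ℍ) : ℂ)) = cexp (-2) := by
  rw [UpperHalfPlane.coe_mk, two_pi_I_mul_I_div_pi]

/-- `S(i/π) = −π/i = iπ`. -/
theorem coe_S_smul_I_div_pi :
    ((S • UpperHalfPlane.mk (I / π) im_I_div_pi_pos : ℍ) : ℂ) = π * I := by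
  rw [modular_S_smul]
  change (-(I / (π : ℂ)))⁻¹ = π * I
  rw [neg_div', inv_div, div_neg, div_I]
  ring

/-- `2πi · (iπ) = −2π²`. -/
theorem two_pi_I_mul_pi_mul_I : 2 * (π : ℂ) * I * (π * I) = -(2 * (π : ℂ) ^ 2) := by
  have : I * I = -1 := I_mul_I
  linear_combination (2 * (π : ℂ) ^ 2) * this

/-- The nome at `S τ₀ = iπ`: `e^{2πi·iπ} = e^{−2π²}`. -/
theorem cexp_two_pi_I_mul_S_smul_I_div_pi :
    cexp (2 * π * I * ((S • UpperHalfPlane.mk (I / π) im_I_div_pi_pos : ℍ) : ℂ)) =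
      cexp (-(2 * (π : ℂ) ^ 2)) := by
  rw [coe_S_smul_I_div_pi, two_pi_I_mul_pi_mul_I]

/-- `denom S τ₀ = τ₀ = i/π`. -/
theorem denom_S_I_div_pi :
    denom (S : GL (Fin 2) ℝ) ((UpperHalfPlane.mk (I / π) im_I_div_pi_pos : ℍ) : ℂ) = I / π := by
  rw [ModularGroup.denom_S, UpperHalfPlane.coe_mk]

/-- **`Q(e^{−2π²}) = Q(e^{−2})/π⁴`** (`E₄(−1/τ) = τ⁴E₄(τ)` at `τ = i/π`). [folklore] -/
theorem ramanujanQ_exp_neg_two_pi_sq :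
    ramanujanQ (cexp (-(2 * (π : ℂ) ^ 2))) = ramanujanQ (cexp (-2)) / (π : ℂ) ^ 4 := by
  rw [← cexp_two_pi_I_mul_S_smul_I_div_pi, ramanujanQ_cexp, E₄_slash_smul, ← ramanujanQ_cexp,
    cexp_two_pi_I_mul_I_div_pi, denom_S_I_div_pi]
  have hπ : (π : ℂ) ≠ 0 := ofReal_ne_zero.mpr Real.pi_ne_zero
  have hI4 : I ^ 4 = 1 := I_pow_four
  rw [div_pow, hI4]
  field_simp

/-- **`R(e^{−2π²}) = −R(e^{−2})/π⁶`** (`E₆(−1/τ) = τ⁶E₆(τ)` at `τ = i/π`). [folklore] -/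
theorem ramanujanR_exp_neg_two_pi_sq :
    ramanujanR (cexp (-(2 * (π : ℂ) ^ 2))) = -ramanujanR (cexp (-2)) / (π : ℂ) ^ 6 := by
  rw [← cexp_two_pi_I_mul_S_smul_I_div_pi, ramanujanR_cexp, E₆_slash_smul, ← ramanujanR_cexp,
    cexp_two_pi_I_mul_I_div_pi, denom_S_I_div_pi]
  have hπ : (π : ℂ) ≠ 0 := ofReal_ne_zero.mpr Real.pi_ne_zero
  have hI6 : I ^ 6 = -1 := by
    rw [show (6 : ℕ) = 4 + 2 from rfl, pow_add, I_pow_four, I_sq]; ring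
  rw [div_pow, hI6]
  field_simp

/-- **`P(e^{−2π²}) = (6 − P(e^{−2}))/π²`** (the `E₂` anomaly `E₂(−1/τ) = τ²E₂(τ) + 6τ/(πi)` at
`τ = i/π`; `−2πi/(2ζ(2)) = −6i/π`). [folklore] -/
theorem ramanujanP_exp_neg_two_pi_sq :
    ramanujanP (cexp (-(2 * (π : ℂ) ^ 2))) = (6 - ramanujanP (cexp (-2))) / (π : ℂ) ^ 2 := by
  rw [← cexp_two_pi_I_mul_S_smul_I_div_pi, ramanujanP_cexp, E2_smul, ← ramanujanP_cexp,
    cexp_two_pi_I_mul_I_div_pi, denom_S_I_div_pi, riemannZeta_two]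
  have hS : ((S : SL(2, ℤ)) 1 0 : ℤ) = 1 := rfl
  rw [hS]
  have hπ : (π : ℂ) ≠ 0 := ofReal_ne_zero.mpr Real.pi_ne_zero
  have hI2 : I ^ 2 = -1 := I_sq
  rw [div_pow, hI2]
  field_simp
  ring_nf
  rw [I_sq]; ring

/-! ### §3 Unconditional: Nesterenko's Theorem 1.1 at the two nomes of the orbit -/

/-- **(M1)** `3 ≤ trdeg ℚ(e^{−2}, P(e^{−2}), Q(e^{−2}), R(e^{−2}))` — Nesterenko 1996 Theorem 1.1
(PROVED in the tree: `nesterenko1996_thm_1_1_holds`) at `q = e^{−2}`. -/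
theorem three_le_trdeg_nome_e :
    (3 : Cardinal) ≤ Algebra.trdeg ℚ ↥(adjoin ℚ ({cexp (-2), ramanujanP (cexp (-2)),
      ramanujanQ (cexp (-2)), ramanujanR (cexp (-2))} : Set ℂ)) := by
  have h := three_le_trdeg_adjoin_of_thm_1_1 nesterenko1996_thm_1_1_holds (I / π) im_I_div_pi_pos
  rwa [two_pi_I_mul_I_div_pi] at h

/-- The field `ℚ(e^{−2π²}, P(e^{−2π²}), Q(e^{−2π²}), R(e^{−2π²}))` lies in
`ℚ(π, e^{−2π²}, P(e^{−2}), Q(e^{−2}), R(e^{−2}))` (the three value identities). -/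
theorem adjoin_nome_pi_le :
    adjoin ℚ ({cexp (-(2 * (π : ℂ) ^ 2)), ramanujanP (cexp (-(2 * (π : ℂ) ^ 2))),
        ramanujanQ (cexp (-(2 * (π : ℂ) ^ 2))), ramanujanR (cexp (-(2 * (π : ℂ) ^ 2)))} : Set ℂ) ≤
      adjoin ℚ ({(π : ℂ), cexp (-(2 * (π : ℂ) ^ 2)), ramanujanP (cexp (-2)),
        ramanujanQ (cexp (-2)), ramanujanR (cexp (-2))} : Set ℂ) := by
  set F := adjoin ℚ ({(π : ℂ), cexp (-(2 * (π : ℂ) ^ 2)), ramanujanP (cexp (-2)),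
    ramanujanQ (cexp (-2)), ramanujanR (cexp (-2))} : Set ℂ) with hF
  have hpi : (π : ℂ) ∈ F := subset_adjoin ℚ _ (by simp)
  have hq : cexp (-(2 * (π : ℂ) ^ 2)) ∈ F := subset_adjoin ℚ _ (by simp)
  have hP : ramanujanP (cexp (-2)) ∈ F := subset_adjoin ℚ _ (by simp)
  have hQ : ramanujanQ (cexp (-2)) ∈ F := subset_adjoin ℚ _ (by simp)
  have hR : ramanujanR (cexp (-2)) ∈ F := subset_adjoin ℚ _ (by simp)
  have h6 : (6 : ℂ) ∈ F := by exact_mod_cast IntermediateField.natCast_mem F 6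
  rw [adjoin_le_iff]
  intro w hw
  simp only [Set.mem_insert_iff, Set.mem_singleton_iff] at hw
  rcases hw with rfl | rfl | rfl | rfl
  · exact hq
  · rw [ramanujanP_exp_neg_two_pi_sq]; exact div_mem (sub_mem h6 hP) (pow_mem hpi 2)
  · rw [ramanujanQ_exp_neg_two_pi_sq]; exact div_mem hQ (pow_mem hpi 4)
  · rw [ramanujanR_exp_neg_two_pi_sq]; exact div_mem (neg_mem hR) (pow_mem hpi 6)

/-- **(M1′)** `3 ≤ trdeg ℚ(π, e^{−2π²}, P(e^{−2}), Q(e^{−2}), R(e^{−2}))` — Theorem 1.1 at the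
`S`-dual nome `q' = e^{−2π²}`, pulled back to the generators at `e^{−2}`. Unconditional. -/
theorem three_le_trdeg_nome_pi :
    (3 : Cardinal) ≤ Algebra.trdeg ℚ ↥(adjoin ℚ ({(π : ℂ), cexp (-(2 * (π : ℂ) ^ 2)),
      ramanujanP (cexp (-2)), ramanujanQ (cexp (-2)), ramanujanR (cexp (-2))} : Set ℂ)) := by
  have h := three_le_trdeg_adjoin_of_thm_1_1 nesterenko1996_thm_1_1_holds
    ((S • UpperHalfPlane.mk (I / π) im_I_div_pi_pos : ℍ) : ℂ)
    (S • UpperHalfPlane.mk (I / π) im_I_div_pi_pos).2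
  rw [cexp_two_pi_I_mul_S_smul_I_div_pi] at h
  exact h.trans (trdeg_mono adjoin_nome_pi_le)

/-- `e^{−2} = (e^{1})⁻¹ · (e^{1})⁻¹`. -/
theorem cexp_neg_two_eq_inv_mul_inv : cexp (-2) = (cexp 1)⁻¹ * (cexp 1)⁻¹ := by
  rw [← Complex.exp_neg, ← Complex.exp_add]; norm_num

/-- **(M1 for `F₆`)** `3 ≤ trdeg ℚ(e, π, e^{π²}, P(e^{−2}), Q(e^{−2}), R(e^{−2}))`, unconditionally
(Nesterenko at `e^{−2}`, and `e^{−2} ∈ ℚ(e)`). -/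
theorem three_le_trdeg_six :
    (3 : Cardinal) ≤ Algebra.trdeg ℚ ↥(adjoin ℚ ({cexp 1, (π : ℂ), cexp ((π : ℂ) ^ 2),
      ramanujanP (cexp (-2)), ramanujanQ (cexp (-2)), ramanujanR (cexp (-2))} : Set ℂ)) := by
  refine three_le_trdeg_nome_e.trans (trdeg_mono ?_)
  set F := adjoin ℚ ({cexp 1, (π : ℂ), cexp ((π : ℂ) ^ 2),
      ramanujanP (cexp (-2)), ramanujanQ (cexp (-2)), ramanujanR (cexp (-2))} : Set ℂ) with hF
  have he : cexp 1 ∈ F := subset_adjoin ℚ _ (by simp)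
  have hP : ramanujanP (cexp (-2)) ∈ F := subset_adjoin ℚ _ (by simp)
  have hQ : ramanujanQ (cexp (-2)) ∈ F := subset_adjoin ℚ _ (by simp)
  have hR : ramanujanR (cexp (-2)) ∈ F := subset_adjoin ℚ _ (by simp)
  rw [adjoin_le_iff]
  intro w hw
  simp only [Set.mem_insert_iff, Set.mem_singleton_iff] at hw
  rcases hw with rfl | rfl | rfl | rfl
  · rw [cexp_neg_two_eq_inv_mul_inv]; exact mul_mem (inv_mem he) (inv_mem he)
  exacts [hP, hQ, hR]

/-! ### §4 `i/π` and `iπ` are not imaginary quadratic -/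

/-- `i/π` is not imaginary quadratic: `(i/π)² + b(i/π) + c = 0` with `b, c ∈ ℚ` forces `b = 0`
and `c π² = 1`, contradicting the irrationality of `π²` (tree:
`CalegariDimitrovTang.irrational_pi_sq`). -/
theorem not_quadratic_I_div_pi : ¬ ∃ b c : ℚ, (I / π) ^ 2 + (b : ℂ) * (I / π) + (c : ℂ) = 0 := by
  rintro ⟨b, c, h⟩
  have hπ : (π : ℂ) ≠ 0 := ofReal_ne_zero.mpr Real.pi_ne_zero
  have key : I / (π : ℂ) * π = I := div_mul_cancel₀ I hπ
  have h' : (-1 : ℂ) + (b : ℂ) * π * I + (c : ℂ) * π ^ 2 = 0 := by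
    have := congrArg (· * (π : ℂ) ^ 2) h
    simp only [zero_mul] at this
    rw [← this]
    have e : ((I / (π : ℂ)) ^ 2 + (b : ℂ) * (I / π) + c) * (π : ℂ) ^ 2 =
        (I / π * π) ^ 2 + (b : ℂ) * π * (I / π * π) + c * π ^ 2 := by ring
    rw [e, key, I_sq]
  have him := congrArg Complex.im h'
  have hre := congrArg Complex.re h'
  simp [pow_two] at him hre
  have hc : (c : ℝ) * Real.pi ^ 2 = 1 := by linear_combination hre
  exact Literature.NumberTheory.Transcendental.CalegariDimitrovTang.irrational_pi_sq
    ⟨c⁻¹, by rw [Rat.cast_inv]; exact inv_eq_of_mul_eq_one_right hc⟩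

/-- `iπ` is not imaginary quadratic (`−π² + b iπ + c = 0 ⟹ b = 0, π² = c`). -/
theorem not_quadratic_pi_mul_I :
    ¬ ∃ b c : ℚ, ((π : ℂ) * I) ^ 2 + (b : ℂ) * (π * I) + (c : ℂ) = 0 := by
  rintro ⟨b, c, h⟩
  have him := congrArg Complex.im h
  have hre := congrArg Complex.re h
  simp [pow_two] at him hre
  have hc : (c : ℝ) = Real.pi ^ 2 := by linear_combination hre
  exact Literature.NumberTheory.Transcendental.CalegariDimitrovTang.irrational_pi_sq ⟨c, hc⟩

end Summit.Schanuel.Schanuel.Theorems
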